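import Mathlib.Data.Fin.Tuple.Sort
import Mathlib.Algebra.Order.BigOperators.Group.Finset
import Mathlib.Algebra.Order.BigOperators.Ring.Finset
import Mathlib.Algebra.BigOperators.Ring.Finset
import Mathlib.Tactic.Linarith
import Mathlib.Tactic.Positivity
import Mathlib.Tactic.Ring
import Mathlib.Data.Real.Basic
import Mathlib.Order.Interval.Finset.Fin

/-!
# `NoHeavyLowerTail` (crux stmt-CriticalPhenomena-4575), abstract sunflower cubic: a DISCRETE LORENTZ REARRANGEMENT INEQUALITY

Support file (seat `prim-ineq-prove-1` gen 35; `--supports stmt-CriticalPhenomena-4575`).  No `sorry`, no named facts.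
Memo: run/shared/lean/prim/prim-ineq-prove-1/FINDING-LSM-prove1-g35.md §3 (Step 5, "discrete Lorentz lemma").

SETTING.  `β` a finite index set; vectors `β → ℕ` with the pointwise lattice order; a FAMILY is `x : Fin m → β → ℕ`.
`Ψ : (β → ℕ) → ℝ` is supermodular if `Ψ x + Ψ y ≤ Ψ (x ⊔ y) + Ψ (x ⊓ y)` for all `x, y`.
* `cnt x i t` — the number of members `g` with `t ≤ x g i` (the distribution function of coordinate `i` over the family).
* `uncross_exists` — every family can be UNCROSSED into a chain family (pairwise comparable members) with the same
  coordinate distributions and no smaller `∑ g, Ψ (x g)` (G. G. Lorentz, Amer. Math. Monthly 60 (1953); proof: replace an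
  incomparable pair by its `⊔, ⊓`; the potential `∑ g (∑ i x g i)²` strictly increases and is bounded by `(∑ g ∑ i x g i)²`).
* **`sum_le_sum_of_chain_of_cnt_le`** (the form used downstream): if `Ψ` is supermodular and monotone, `y` is a chain family and
  every coordinate distribution of `x` is dominated by that of `y` (`cnt x i t ≤ cnt y i t`), then `∑ g, Ψ (x g) ≤ ∑ g, Ψ (y g)`
  (uncross `x`, sort both chains by row sums, compare rank by rank).
-/

namespace Summit.CriticalPhenomena.PercolationContinuityZ3.Theorems.SunflowerPartition

namespace Lorentz

open Finset

variable {β : Type*}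

/-- Distribution function of coordinate `i` over the family: the number of members `g` with `t ≤ x g i`. [this work] -/
def cnt {m : ℕ} (x : Fin m → β → ℕ) (i : β) (t : ℕ) : ℕ := ∑ g, if t ≤ x g i then 1 else 0

/-- `cnt` is invariant under re-indexing the family. [this work] -/
theorem cnt_comp_perm {m : ℕ} (x : Fin m → β → ℕ) (σ : Equiv.Perm (Fin m)) (i : β) (t : ℕ) :
    cnt (x ∘ σ) i t = cnt x i t := by
  unfold cnt
  exact Equiv.sum_comp σ (fun g => if t ≤ x g i then 1 else 0)

/-! ## Pair updates -/

/-- Replace the members `g, g'` by `a, b`. [this work] -/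
def upd {m : ℕ} (x : Fin m → β → ℕ) (g g' : Fin m) (a b : β → ℕ) : Fin m → β → ℕ :=
  Function.update (Function.update x g a) g' b

/-- Value of the update at `g`. [this work] -/
theorem upd_fst {m : ℕ} (x : Fin m → β → ℕ) {g g' : Fin m} (h : g ≠ g') (a b : β → ℕ) : upd x g g' a b g = a := by
  unfold upd; rw [Function.update_of_ne h, Function.update_self]

/-- Value of the update at `g'`. [this work] -/
theorem upd_snd {m : ℕ} (x : Fin m → β → ℕ) (g g' : Fin m) (a b : β → ℕ) : upd x g g' a b g' = b := by
  unfold upd; rw [Function.update_self]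

/-- Value of the update elsewhere. [this work] -/
theorem upd_of_ne {m : ℕ} (x : Fin m → β → ℕ) {g g' k : Fin m} (hg : k ≠ g) (hg' : k ≠ g') (a b : β → ℕ) :
    upd x g g' a b k = x k := by
  unfold upd; rw [Function.update_of_ne hg', Function.update_of_ne hg]

/-- Sums over a pair update (additive form, valid in any commutative monoid). [this work] -/
theorem sum_upd {m : ℕ} {M : Type*} [AddCommMonoid M] (F : (β → ℕ) → M) (x : Fin m → β → ℕ) {g g' : Fin m}
    (h : g ≠ g') (a b : β → ℕ) :
    ∑ k, F (upd x g g' a b k) + (F (x g) + F (x g')) = ∑ k, F (x k) + (F a + F b) := by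
  classical
  have hg : g ∈ (univ : Finset (Fin m)) := mem_univ _
  have hg' : g' ∈ (univ : Finset (Fin m)).erase g := mem_erase.2 ⟨h.symm, mem_univ _⟩
  rw [← add_sum_erase _ _ hg, ← add_sum_erase _ _ hg', ← add_sum_erase _ (fun k => F (x k)) hg,
    ← add_sum_erase _ (fun k => F (x k)) hg', upd_fst x h, upd_snd]
  have hrest : ∑ k ∈ ((univ : Finset (Fin m)).erase g).erase g', F (upd x g g' a b k) =
      ∑ k ∈ ((univ : Finset (Fin m)).erase g).erase g', F (x k) := by
    refine sum_congr rfl fun k hk => ?_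
    rw [mem_erase, mem_erase] at hk
    rw [upd_of_ne x hk.2.1 hk.1]
  rw [hrest]
  simp only [add_assoc, add_left_comm, add_comm]

/-- `cnt` is invariant under uncrossing a pair. [this work] -/
theorem cnt_upd {m : ℕ} (x : Fin m → β → ℕ) {g g' : Fin m} (h : g ≠ g') (i : β) (t : ℕ) :
    cnt (upd x g g' (x g ⊔ x g') (x g ⊓ x g')) i t = cnt x i t := by
  have key := sum_upd (fun v => if t ≤ v i then 1 else 0) x h (x g ⊔ x g') (x g ⊓ x g')
  have hpair : (if t ≤ (x g ⊔ x g') i then 1 else 0) + (if t ≤ (x g ⊓ x g') i then 1 else 0)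
      = (if t ≤ x g i then 1 else 0) + (if t ≤ x g' i then 1 else 0) := by
    simp only [Pi.sup_apply, Pi.inf_apply]
    rcases le_total (x g i) (x g' i) with hle | hle
    · simp only [sup_of_le_right hle, inf_of_le_left hle, add_comm]
    · simp only [sup_of_le_left hle, inf_of_le_right hle]
  unfold cnt
  rw [hpair] at key
  exact add_right_cancel key

variable [Fintype β]

/-- Row sum of a member. [this work] -/
def rs (v : β → ℕ) : ℕ := ∑ i, v i

/-- The potential `∑ g (rs (x g))²`. [this work] -/
def pot {m : ℕ} (x : Fin m → β → ℕ) : ℕ := ∑ g, rs (x g) ^ 2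

/-- Total mass `∑ g rs (x g)`. [this work] -/
def tot {m : ℕ} (x : Fin m → β → ℕ) : ℕ := ∑ g, rs (x g)

/-! ## The uncrossing step -/

/-- `rs` is modular. [this work] -/
theorem rs_sup_add_rs_inf (u v : β → ℕ) : rs (u ⊔ v) + rs (u ⊓ v) = rs u + rs v := by
  unfold rs; rw [← sum_add_distrib, ← sum_add_distrib]
  refine sum_congr rfl fun i _ => ?_
  simp only [Pi.sup_apply, Pi.inf_apply]
  rcases le_total (u i) (v i) with h | h
  · rw [sup_of_le_right h, inf_of_le_left h, add_comm]
  · rw [sup_of_le_left h, inf_of_le_right h]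

/-- Strict growth of the row sum under a proper join. [this work] -/
theorem rs_lt_rs_sup_of_not_le {u v : β → ℕ} (h : ¬ v ≤ u) : rs u < rs (u ⊔ v) := by
  unfold rs
  obtain ⟨i, hi⟩ : ∃ i, u i < v i := by
    by_contra hc; push Not at hc; exact h hc
  exact sum_lt_sum (fun j _ => le_sup_left) ⟨i, mem_univ _, by simp only [Pi.sup_apply]; omega⟩

/-- `tot` is invariant under uncrossing a pair. [this work] -/
theorem tot_upd {m : ℕ} (x : Fin m → β → ℕ) {g g' : Fin m} (h : g ≠ g') :
    tot (upd x g g' (x g ⊔ x g') (x g ⊓ x g')) = tot x := by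
  have key := sum_upd (fun v => rs v) x h (x g ⊔ x g') (x g ⊓ x g')
  rw [rs_sup_add_rs_inf (x g) (x g')] at key
  unfold tot
  exact add_right_cancel key

/-- The potential strictly increases when an incomparable pair is uncrossed. [this work] -/
theorem pot_lt_pot_upd {m : ℕ} (x : Fin m → β → ℕ) {g g' : Fin m} (h : g ≠ g')
    (h1 : ¬ x g' ≤ x g) (h2 : ¬ x g ≤ x g') :
    pot x < pot (upd x g g' (x g ⊔ x g') (x g ⊓ x g')) := by
  have key := sum_upd (fun v => rs v ^ 2) x h (x g ⊔ x g') (x g ⊓ x g')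
  have hsum := rs_sup_add_rs_inf (x g) (x g')
  have hlt1 : rs (x g) < rs (x g ⊔ x g') := rs_lt_rs_sup_of_not_le h1
  have hlt2 : rs (x g') < rs (x g ⊔ x g') := by
    have := rs_lt_rs_sup_of_not_le (u := x g') (v := x g) h2
    rwa [sup_comm] at this
  have hgain : rs (x g) ^ 2 + rs (x g') ^ 2 < rs (x g ⊔ x g') ^ 2 + rs (x g ⊓ x g') ^ 2 := by
    set u := rs (x g ⊔ x g'); set l := rs (x g ⊓ x g'); set s := rs (x g); set s' := rs (x g')
    have hl : (l : ℤ) = s + s' - u := by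
      have : ((u + l : ℕ) : ℤ) = ((s + s' : ℕ) : ℤ) := by exact_mod_cast hsum
      push_cast at this; linarith
    have : (s : ℤ) ^ 2 + (s' : ℤ) ^ 2 < (u : ℤ) ^ 2 + (l : ℤ) ^ 2 := by
      rw [hl]
      have hu1 : (s : ℤ) < u := by exact_mod_cast hlt1
      have hu2 : (s' : ℤ) < u := by exact_mod_cast hlt2
      nlinarith
    exact_mod_cast this
  unfold pot
  omega

/-- The potential is bounded by the square of the total mass. [this work] -/
theorem pot_le_tot_sq {m : ℕ} (x : Fin m → β → ℕ) : pot x ≤ tot x ^ 2 := by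
  unfold pot tot
  rw [sq, Finset.sum_mul]
  refine sum_le_sum fun k _ => ?_
  rw [sq]
  exact Nat.mul_le_mul_left _ (single_le_sum (f := fun g => rs (x g)) (fun j _ => Nat.zero_le _) (mem_univ k))

omit [Fintype β] in
/-- Uncrossing a pair does not decrease `∑ Ψ` for supermodular `Ψ`. [this work] -/
theorem sum_le_sum_upd {m : ℕ} {Ψ : (β → ℕ) → ℝ} (hΨ : ∀ u v : β → ℕ, Ψ u + Ψ v ≤ Ψ (u ⊔ v) + Ψ (u ⊓ v))
    (x : Fin m → β → ℕ) {g g' : Fin m} (h : g ≠ g') :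
    ∑ k, Ψ (x k) ≤ ∑ k, Ψ (upd x g g' (x g ⊔ x g') (x g ⊓ x g') k) := by
  have key := sum_upd Ψ x h (x g ⊔ x g') (x g ⊓ x g')
  have := hΨ (x g) (x g')
  linarith

/-- **Uncrossing** (Lorentz): a chain family with the same coordinate distributions and no smaller `∑ Ψ`.  The natural number `n`
bounds the potential gap `tot² − pot` and drives the induction. [this work] -/
theorem uncross_exists {m : ℕ} {Ψ : (β → ℕ) → ℝ} (hΨ : ∀ u v : β → ℕ, Ψ u + Ψ v ≤ Ψ (u ⊔ v) + Ψ (u ⊓ v)) :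
    ∀ (n : ℕ) (x : Fin m → β → ℕ), tot x ^ 2 - pot x ≤ n →
      ∃ z : Fin m → β → ℕ, (∀ g g', z g ≤ z g' ∨ z g' ≤ z g) ∧ (∀ i t, cnt z i t = cnt x i t) ∧
        ∑ k, Ψ (x k) ≤ ∑ k, Ψ (z k) := by
  intro n
  induction n with
  | zero =>
    intro x hx
    by_cases hc : ∀ g g', x g ≤ x g' ∨ x g' ≤ x g
    · exact ⟨x, hc, fun _ _ => rfl, le_rfl⟩
    · exfalso
      push Not at hc
      obtain ⟨g, g', h1, h2⟩ := hc
      have hne : g ≠ g' := by rintro rfl; exact h1 le_rfl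
      have hlt := pot_lt_pot_upd x hne h2 h1
      have hle := pot_le_tot_sq (upd x g g' (x g ⊔ x g') (x g ⊓ x g'))
      rw [tot_upd x hne] at hle
      omega
  | succ n ih =>
    intro x hx
    by_cases hc : ∀ g g', x g ≤ x g' ∨ x g' ≤ x g
    · exact ⟨x, hc, fun _ _ => rfl, le_rfl⟩
    · push Not at hc
      obtain ⟨g, g', h1, h2⟩ := hc
      have hne : g ≠ g' := by rintro rfl; exact h1 le_rfl
      have hlt := pot_lt_pot_upd x hne h2 h1
      have hle := pot_le_tot_sq (upd x g g' (x g ⊔ x g') (x g ⊓ x g'))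
      have htot := tot_upd x hne
      have hgoal : tot (upd x g g' (x g ⊔ x g') (x g ⊓ x g')) ^ 2 - pot (upd x g g' (x g ⊔ x g') (x g ⊓ x g')) ≤ n := by
        rw [htot]; omega
      obtain ⟨z, hz, hcz, hsz⟩ := ih (upd x g g' (x g ⊔ x g') (x g ⊓ x g')) hgoal
      exact ⟨z, hz, fun i t => by rw [hcz, cnt_upd x hne], (sum_le_sum_upd hΨ x hne).trans hsz⟩

/-! ## Chain families can be sorted -/

/-- In a chain, the row sums decide the order. [this work] -/
theorem le_of_chain_of_rs_le {u v : β → ℕ} (hc : u ≤ v ∨ v ≤ u) (hs : rs u ≤ rs v) : u ≤ v := by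
  rcases hc with h | h
  · exact h
  · have heq : rs v = rs u := le_antisymm (sum_le_sum fun i _ => h i) hs
    have hall : ∀ i ∈ (univ : Finset β), v i = u i :=
      (sum_eq_sum_iff_of_le (f := v) (g := u) (s := univ) fun i _ => h i).1 heq
    intro i; rw [hall i (mem_univ i)]

/-- A chain family admits a permutation making it monotone (sort by row sums). [this work] -/
theorem exists_perm_monotone {m : ℕ} {z : Fin m → β → ℕ} (hz : ∀ g g', z g ≤ z g' ∨ z g' ≤ z g) :
    ∃ σ : Equiv.Perm (Fin m), Monotone (z ∘ σ) := by
  refine ⟨Tuple.sort (fun g => rs (z g)), fun j j' hjj' => ?_⟩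
  have hs := Tuple.monotone_sort (fun g => rs (z g)) hjj'
  exact le_of_chain_of_rs_le (hz _ _) hs

/-! ## Dominance of sorted sequences from dominance of distribution functions -/

omit [Fintype β] in
/-- For two monotone sequences, domination of all upper level counts gives rankwise domination. [this work] -/
theorem sorted_le_of_cnt_le {m : ℕ} {u v : Fin m → ℕ} (hu : Monotone u) (hv : Monotone v)
    (h : ∀ t, (∑ j, if t ≤ u j then 1 else 0 : ℕ) ≤ ∑ j, if t ≤ v j then 1 else 0) : ∀ j, u j ≤ v j := by
  classical
  intro j
  by_contra hlt; push Not at hlt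
  set t := u j with ht
  have hA : (Finset.Ici j).card ≤ ∑ k, if t ≤ u k then 1 else 0 := by
    rw [Finset.sum_boole]
    refine card_le_card fun k hk => ?_
    rw [mem_filter]; rw [Finset.mem_Ici] at hk
    exact ⟨mem_univ _, hu hk⟩
  have hB : (∑ k, if t ≤ v k then 1 else 0 : ℕ) ≤ (Finset.Ioi j).card := by
    rw [Finset.sum_boole]
    refine card_le_card fun k hk => ?_
    rw [mem_filter] at hk; rw [Finset.mem_Ioi]
    by_contra hkj; push Not at hkj
    exact absurd (hk.2.trans (hv hkj)) (not_le.2 hlt)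
  have := (hA.trans (h t)).trans hB
  rw [Fin.card_Ici, Fin.card_Ioi] at this
  omega

/-! ## The inequality -/

/-- **Discrete Lorentz inequality, domination form.**  `Ψ` supermodular and monotone, `y` a chain family whose coordinate
distributions dominate those of `x`: `∑ g, Ψ (x g) ≤ ∑ g, Ψ (y g)`. [this work] -/
theorem sum_le_sum_of_chain_of_cnt_le {m : ℕ} {Ψ : (β → ℕ) → ℝ}
    (hΨ : ∀ u v : β → ℕ, Ψ u + Ψ v ≤ Ψ (u ⊔ v) + Ψ (u ⊓ v)) (hΨm : Monotone Ψ)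
    (x y : Fin m → β → ℕ) (hy : ∀ g g', y g ≤ y g' ∨ y g' ≤ y g) (hdom : ∀ i t, cnt x i t ≤ cnt y i t) :
    ∑ g, Ψ (x g) ≤ ∑ g, Ψ (y g) := by
  obtain ⟨z, hz, hcz, hsz⟩ := uncross_exists hΨ (tot x ^ 2 - pot x) x le_rfl
  refine hsz.trans ?_
  obtain ⟨σ, hσ⟩ := exists_perm_monotone hz
  obtain ⟨σ', hσ'⟩ := exists_perm_monotone hy
  rw [← Equiv.sum_comp σ (fun g => Ψ (z g)), ← Equiv.sum_comp σ' (fun g => Ψ (y g))]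
  refine sum_le_sum fun j _ => hΨm fun i => ?_
  have hu : Monotone fun j => z (σ j) i := fun a b hab => hσ hab i
  have hv : Monotone fun j => y (σ' j) i := fun a b hab => hσ' hab i
  refine sorted_le_of_cnt_le hu hv (fun t => ?_) j
  have h1 := cnt_comp_perm z σ i t
  have h2 := cnt_comp_perm y σ' i t
  have h3 := hdom i t
  rw [← hcz i t, ← h1, ← h2] at h3
  exact h3

end Lorentz

end Summit.CriticalPhenomena.PercolationContinuityZ3.Theorems.SunflowerPartition
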